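import Mathlib
import Literature.NumberTheory.LFunctions.Zhang2022.DetectorClassDET
import Literature.NumberTheory.LFunctions.Zhang2022.DetectorSignLemma
import HarnessLib

/-!
# Zhang (2022), programme F-S3 (cell landau-siegel, family B-det): the W2 shift detectors as members of class DET,
# with their sign input DISCHARGED (SignLemma_S, E-086) — the bridge `DETDesign ← ShiftData` for the class sentence

Y. Zhang, *Discrete mean estimates and the Landau–Siegel zero*, arXiv:2211.02515v1 [Zhang2022LandauSiegel] —
an unrefereed manuscript under adjudication. **WHAT THIS IS NOT: not a claim about Theorems 1–2 of
arXiv:2211.02515, about Landau–Siegel zeros, or about Parity; nothing here asserts any claim of the manuscript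
(everything detector-level is conditional on its Proposition 2.2, the CLAIM node `Skeleton.Prop22 c′`).**
«The programme SEARCHES and TYPES; no claim about Landau–Siegel zeros, Theorems 1–2 of arXiv:2211.02515 or a
repaired Margin232 until a kernel theorem says so.»

The cell's class DET (`Det.DETDesign`, `DetectorClassDET.lean`, ls-Bdet-typer-2) holds every detector of the B-det
design maps; its W2 sub-family («shift detectors», `B-det/PLAN.md` §4) is the image of the 3-shift data
`S = (b, e)` (`DetTemplate.ShiftData 3`) with the product weight `−i·Π_jM(ρ+β_j)/M′(ρ)·ω(ρ)` on `(Ψ₁, 𝔷(ψ))`.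
This leaf file (imports both sides; neither side imports it) records that embedding and transports the PROVED sign
lemma of `DetectorSignLemma.lean` to the DET member:

* `Det.shiftDesign S hS : DETDesign 3` (`P₀ = 0`, `P₁ = X₀X₁X₂`, `c₀ = −i`, `Σ₁`, `Ψ₁`, amplifier `1`; `hS : InShiftBox S.b`
  is the class's `b ∈ (0,5)³`), `shiftDesign_zhangShift` (`= zhangDesign`);
* `weight_shiftDesign` (`= 𝔠*_S(ρ,ψ)ω(ρ)`), **`detector_shiftDesign : (shiftDesign S hS).detector c′ = shiftDetector S c′`**;
* **`positive_detector_shiftDesign : SignRobust S → 0 ≤ c′ → Prop22 c′ → ((shiftDesign S hS).detector c′).Positive`**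
  and the main-values form `positive_detector_shiftDesign_of_signAdmissible` (data `(b; −1, 1, −1)`), i.e. for the
  W2 members of DET the (2.16)/(B1) sign input is a theorem given Prop. 2.2 (registry E-086), so their Cauchy–Schwarz
  words rest on `DetTemplate.Detector.Positive.cauchySchwarz` / `Det.not_mainOrder_closing` alone.

No new named facts; bookkeeping over landed objects.
-/

noncomputable section

open Complex Real

namespace Literature.NumberTheory.LFunctions.Zhang2022.Det

open Skeleton DetTemplate

/-- `X₀X₁X₂` has total degree `≤ 3`. [folklore] -/
private theorem totalDegree_zhangPoly_le' : zhangPoly.totalDegree ≤ 3 := by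
  unfold zhangPoly
  refine (MvPolynomial.totalDegree_finsetProd _ _).trans ?_
  simp [MvPolynomial.totalDegree_X]

/-- `0` has total degree `≤ 3`. [folklore] -/
private theorem totalDegree_zero_le_three' {k : ℕ} : (0 : MvPolynomial (Fin k) ℂ).totalDegree ≤ 3 := by
  simp

/-- **The W2 member of class DET with shift data `S`** (B-det/PLAN §4 family W2): shifts `S = (b, e)` in the Part-III
box, weight `−i·M(ρ+β₀)M(ρ+β₁)M(ρ+β₂)/M′(ρ)·ω(ρ)` (`P₀ = 0`, `P₁ = X₀X₁X₂`, `c₀ = −i`), sampled on `𝔷(ψ)`, family `Ψ₁`,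
trivial amplifier — the manuscript's detector with its shift triple replaced. [cite: Zhang2022LandauSiegel, §2 (2.13)–(2.16), Lemma 2.3] -/
def shiftDesign (S : ShiftData 3) (hS : InShiftBox S.b) : DETDesign 3 where
  shift := S
  b_mem := hS
  P0 := 0
  deg0_le := totalDegree_zero_le_three'
  P1 := zhangPoly
  deg1_le := totalDegree_zhangPoly_le'
  c0 := -I
  sampling := .zerosL
  family := .psiOne
  amp := fun _ _ _ _ => 1
  amp_nonneg := fun _ _ _ _ => zero_le_one

/-- At the printed data the W2 member is the manuscript's design `zhangDesign`. [cite: Zhang2022LandauSiegel, §2 (2.13)–(2.16)] -/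
theorem shiftDesign_zhangShift : shiftDesign zhangShift inShiftBox_std = zhangDesign := rfl

/-- The weight of the W2 member is `𝔠*_S(ρ,ψ)ω(ρ)`. [cite: Zhang2022LandauSiegel, §2 p. 5, (2.15)] -/
theorem weight_shiftDesign (S : ShiftData 3) (hS : InShiftBox S.b) (c' : ℝ) (D : ℕ) [NeZero D]
    (χ : DirichletCharacter ℂ D) (x : Chr D) (ρ : ℂ) :
    (shiftDesign S hS).weight c' D χ x ρ = cstarS S c' D x ρ * omegaW D ρ := by
  have hev : MvPolynomial.eval (fun j => Mfun x.ψ (ρ + S.beta c' D j)) zhangPoly =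
      ∏ j, Mfun x.ψ (ρ + S.beta c' D j) := by
    unfold zhangPoly
    rw [map_prod]
    simp only [MvPolynomial.eval_X]
  simp only [DETDesign.weight, shiftDesign, map_zero, zero_add, Complex.ofReal_one, mul_one, cstarS, hev]
  ring

/-- **The skeleton detector of the W2 member IS the shift detector `shiftDetector S c′`** (so every
`DetectorTemplate`/`DetectorSignLemma` statement about `shiftDetector` is a statement about this DET member).
[cite: Zhang2022LandauSiegel, §2 (2.14)–(2.16)] -/
theorem detector_shiftDesign (S : ShiftData 3) (hS : InShiftBox S.b) (c' : ℝ) :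
    (shiftDesign S hS).detector c' = shiftDetector S c' := by
  unfold DETDesign.detector shiftDetector
  congr 1
  funext D _ χ x ρ
  exact weight_shiftDesign S hS c' D χ x ρ

/-- **The sign input of a W2 member of DET is a THEOREM given Prop. 2.2** (registry E-086 «SignLemma_S»,
`Det.positive_shiftDetector`): for robustly sign-admissible data and `c′ ≥ 0` the member's detector is `Positive`.
[cite: Zhang2022LandauSiegel, §2 Lemma 2.3 (proof) pp. 11–12, (2.15)–(2.16)] -/
theorem positive_detector_shiftDesign {S : ShiftData 3} (hS : InShiftBox S.b) (hR : SignRobust S) {c' : ℝ}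
    (hc' : 0 ≤ c') (h22 : Skeleton.Prop22 c') : ((shiftDesign S hS).detector c').Positive := by
  rw [detector_shiftDesign]
  exact positive_shiftDetector hR hc' h22

/-- **Main-values form:** for a sign-admissible triple `b` in the Part-III box, the W2 member with the canonical
corrections `e = (−1, 1, −1)` has a `Positive` detector given Prop. 2.2 (`c′ ≥ 0`).
[cite: Zhang2022LandauSiegel, §2 Lemma 2.3 (proof) pp. 11–12, (2.13)] -/
theorem positive_detector_shiftDesign_of_signAdmissible {b : Fin 3 → ℝ} (hb : SignAdmissible b)
    (hbox : InShiftBox b) {c' : ℝ} (hc' : 0 ≤ c') (h22 : Skeleton.Prop22 c') :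
    ((shiftDesign ⟨b, ![-1, 1, -1]⟩ hbox).detector c').Positive :=
  positive_detector_shiftDesign hbox (signRobust_of_signAdmissible hb) hc' h22

/-- … hence (2.16) for the member: its discrete mean squares are non-negative reals for all large `D`, and its
Cauchy–Schwarz endgame is the unconditional `Detector.Positive.cauchySchwarz` — the «decided: (B1)» word of a W2 × CS
design row, GIVEN Prop. 2.2 only. [cite: Zhang2022LandauSiegel, §2 (2.16)] -/
theorem ineq216_detector_shiftDesign {S : ShiftData 3} (hS : InShiftBox S.b) (hR : SignRobust S) {c' : ℝ}
    (hc' : 0 ≤ c') (h22 : Skeleton.Prop22 c') :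
    ForAllLarge fun D _ χ => ∀ F : Chr D → ℂ → ℂ,
      0 ≤ (((shiftDesign S hS).detector c').mean χ fun x ρ => F x ρ * (starRingEnd ℂ) (F x ρ)).re ∧
        (((shiftDesign S hS).detector c').mean χ fun x ρ => F x ρ * (starRingEnd ℂ) (F x ρ)).im = 0 :=
  (positive_detector_shiftDesign hS hR hc' h22).ineq216

end Literature.NumberTheory.LFunctions.Zhang2022.Det
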